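import Literature.Geometry.Lorentzian.DevelopmentGluing
import HarnessLib

/-!
# Sbierski's Theorem 17 from Theorem 12: the MCGHD has no corresponding boundary points

J. Sbierski, Ann. Henri Poincaré 17 (2016) 301–329 = arXiv:1309.7591v3, §3.2. Theorem 12
(*"NotMCGHD"*): if a common globally hyperbolic development `U` of two GHDs `M`, `M'` of the same
data has corresponding boundary points, then there is a strictly larger CGHD of `M` and `M'`; in
particular `U` is not the MCGHD. Theorem 17 (*"TNDVersion"*): *"Invoking the tertium non datur,
Theorem 12 implies: let `U` be the MCGHD of `M` and `M'`. Then `U` does not have corresponding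
boundary points."* This file formalizes exactly that implication, over the MCGHD of Theorem 10
(`CauchyDevelopment.mcghd`, `CauchyDevelopment.isCommonDevelopment_mcghd`,
`CauchyDevelopment.le_mcghd`, file `MaximalCommonDevelopment`) and the corresponding-boundary-point
predicate of Definition 11 (`CauchyDevelopment.CommonDevelopment.HasCorrespondingBoundaryPoints`,
file `DevelopmentGluingData`):

* `CauchyDevelopment.not_hasCorrespondingBoundaryPoints_mcghd_of_exists_lt` — Theorem 17 for one
  pair of developments from Theorem 12 for that pair (displayed hypothesis `h12`: every common
  development datum with corresponding boundary points is strictly contained in a common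
  development);
* `VacuumCauchyDevelopment.mcghd_noCorrespondingBoundary_of_exists_lt` — the same in the shape of
  the input `h17` of `choquetBruhat_geroch_common_extension_of_localTheory_of_mcghd_noCorrespondingBoundary`
  (file `DevelopmentGluing`), so that the common-extension theorem (Sbierski Thm. 5) and the
  existence of the MGHD are reduced to Theorem 4 (local theory) and **Theorem 12** — whose printed
  proof (Prop. 13, Lemmas 14–16: causality theory of O'Neill 1983, Ch. 14 / Ringström 2009,
  Ch. 23, and a further application of the local theory across a spacelike piece of `∂U`) is the
  remaining unformalized part of §3.2;
* `choquetBruhat_geroch_common_extension_of_localTheory_of_exists_lt` — Sbierski's Theorem 5 for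
  vacuum developments from Theorem 4 and Theorem 12 (and the differentiability of unit normals,
  `hν`, kept displayed here exactly as in `DevelopmentGluing`).

Everything is proved; no definitions, no named facts (D-0026).

## References

* J. Sbierski, Ann. Henri Poincaré 17 (2016) 301–329 = arXiv:1309.7591v3, §3.1 Thm. 10, §3.2
  Def. 11, Thm. 12, Thm. 17, §3.3. [Sbierski2016AHP]
* H. Ringström, *The Cauchy Problem in General Relativity*, EMS 2009, Ch. 23. [Ringstrom2009]
-/

noncomputable section

open Bundle Set Function TopologicalSpace
open scoped Manifold ContDiff Topology

namespace Literature.Geometry.Lorentzian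

universe u

variable {n : ℕ} {X : Type u} [TopologicalSpace X] [ChartedSpace (EuclideanSpace ℝ (Fin n)) X]
  [IsManifold (𝓡 n) ∞ X] [ConnectedSpace X] {D : InitialDataSet (𝓡 n) X}

namespace CauchyDevelopment

/-- **Sbierski 2016, Theorem 17 from Theorem 12 (one pair of developments).** If every common
globally hyperbolic development datum `(U, ψ)` of `𝒟` and `𝒟'` with corresponding boundary
points is strictly contained in a common globally hyperbolic development (Theorem 12), then the
MCGHD (Theorem 10, `isCommonDevelopment_mcghd`) has no corresponding boundary points: a strictly
larger common development would contradict its maximality (`le_mcghd`) — *"invoking the tertium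
non datur"*. [cite: Sbierski2016AHP, §3.2, Thm. 17 from Thm. 12 (arXiv numbering)] -/
theorem not_hasCorrespondingBoundaryPoints_mcghd_of_exists_lt {𝒟 𝒟' : CauchyDevelopment D}
    (h12 : ∀ 𝔠 : CommonDevelopment 𝒟 𝒟', 𝔠.HasCorrespondingBoundaryPoints →
      ∃ V : Opens 𝒟.carrier, 𝒟.IsCommonDevelopment 𝒟'.toDataEmbedding V ∧ 𝔠.opens < V)
    (hne : ∃ U : Opens 𝒟.carrier, 𝒟.IsCommonDevelopment 𝒟'.toDataEmbedding U) :
    ¬ (CommonDevelopment.ofIsCommonDevelopment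
      (𝒟.isCommonDevelopment_mcghd hne)).HasCorrespondingBoundaryPoints := fun hc ↦ by
  obtain ⟨V, hV, hlt⟩ := h12 _ hc
  exact lt_irrefl _ (hlt.trans_le (𝒟.le_mcghd hV))

end CauchyDevelopment

namespace VacuumCauchyDevelopment

/-- **Theorem 17 from Theorem 12, for all pairs of vacuum developments of `D`**, in the shape of
the input `h17` of `choquetBruhat_geroch_common_extension_of_localTheory_of_mcghd_noCorrespondingBoundary`.
[cite: Sbierski2016AHP, §3.2, Thm. 17 from Thm. 12 (arXiv numbering)] -/
theorem mcghd_noCorrespondingBoundary_of_exists_lt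
    (h12 : ∀ (𝒟 𝒟' : VacuumCauchyDevelopment.{u} D)
      (𝔠 : CauchyDevelopment.CommonDevelopment 𝒟.toCauchyDevelopment 𝒟'.toCauchyDevelopment),
      𝔠.HasCorrespondingBoundaryPoints →
        ∃ V : Opens 𝒟.carrier,
          𝒟.toCauchyDevelopment.IsCommonDevelopment 𝒟'.toDataEmbedding V ∧ 𝔠.opens < V) :
    ∀ (𝒟 𝒟' : VacuumCauchyDevelopment.{u} D)
      (hne : ∃ U : Opens 𝒟.carrier,
        𝒟.toCauchyDevelopment.IsCommonDevelopment 𝒟'.toDataEmbedding U),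
      ¬ (CauchyDevelopment.CommonDevelopment.ofIsCommonDevelopment
        (𝒟.toCauchyDevelopment.isCommonDevelopment_mcghd hne)).HasCorrespondingBoundaryPoints :=
  fun 𝒟 𝒟' hne ↦
    CauchyDevelopment.not_hasCorrespondingBoundaryPoints_mcghd_of_exists_lt (h12 𝒟 𝒟') hne

end VacuumCauchyDevelopment

/-- **Sbierski's Theorem 5 (common extension, vacuum) from Theorem 4 and Theorem 12**: if (i) any
two vacuum Cauchy developments of `D` have some common globally hyperbolic development (Thm. 4,
local existence and uniqueness) and (ii) every common development datum with corresponding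
boundary points is strictly contained in a common development (Thm. 12), then any two vacuum Cauchy
developments of `D` embed into a common one (gluing along the MCGHD, which has no corresponding
boundary points by Thm. 17 = `VacuumCauchyDevelopment.mcghd_noCorrespondingBoundary_of_exists_lt`).
The differentiability `hν` of unit normals along data embeddings is displayed as in
`choquetBruhat_geroch_common_extension_of_localTheory_of_mcghd_noCorrespondingBoundary` (it holds
for every data embedding, `DataEmbedding.mdifferentiableAt_embed_normal`, file
`DataEmbeddingNormalSmooth`). [cite: Sbierski2016AHP, §3.3, proof of Thm. 5 with Thm. 4, Thm. 10, Thm. 12/17 (arXiv numbering)] -/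
theorem choquetBruhat_geroch_common_extension_of_localTheory_of_exists_lt
    (hlocal : ∀ 𝒟 𝒟' : VacuumCauchyDevelopment.{u} D,
      ∃ U : Opens 𝒟.carrier, 𝒟.toCauchyDevelopment.IsCommonDevelopment 𝒟'.toDataEmbedding U)
    (h12 : ∀ (𝒟 𝒟' : VacuumCauchyDevelopment.{u} D)
      (𝔠 : CauchyDevelopment.CommonDevelopment 𝒟.toCauchyDevelopment 𝒟'.toCauchyDevelopment),
      𝔠.HasCorrespondingBoundaryPoints →
        ∃ V : Opens 𝒟.carrier,
          𝒟.toCauchyDevelopment.IsCommonDevelopment 𝒟'.toDataEmbedding V ∧ 𝔠.opens < V)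
    (hν : ∀ (𝒟 : VacuumCauchyDevelopment.{u} D) (x : X),
      MDifferentiableAt (𝓡 n) (𝓡 (n + 1)).tangent
        (fun x ↦ (TotalSpace.mk' (EuclideanSpace ℝ (Fin (n + 1))) (𝒟.embed x) (𝒟.normal x) :
          TangentBundle (𝓡 (n + 1)) 𝒟.carrier)) x) :
    ∀ 𝒟₁ 𝒟₂ : VacuumCauchyDevelopment.{u} D, ∃ 𝒟₃ : VacuumCauchyDevelopment.{u} D,
      𝒟₁.toCauchyDevelopment.EmbedsInto 𝒟₃.toCauchyDevelopment ∧
        𝒟₂.toCauchyDevelopment.EmbedsInto 𝒟₃.toCauchyDevelopment :=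
  choquetBruhat_geroch_common_extension_of_localTheory_of_mcghd_noCorrespondingBoundary hlocal
    (VacuumCauchyDevelopment.mcghd_noCorrespondingBoundary_of_exists_lt h12) hν

end Literature.Geometry.Lorentzian

end
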